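import Summits.AtomisticToContinuum.Crystallization.Theses.GrainCoreNetworkSplit

/-!
# `GrainCoreNetworkSplit.Assembly` — the assembly item BY NAME

The assembly item `Assembly` (`stmt-AtomisticToContinuum-27074`, rank 1) of route `GrainCoreNetworkSplit`
(sub-problem `Crystallization` of `AtomisticToContinuum`, a child node refining
`FrustratedLawDichotomy.AperiodicFrustratedLawGap`) is literally the curried type of the route's sorry-free deciding
theorem `Theses.GrainCoreNetworkSplit.closes`: μ-equilibrium door → matrix-grain law gap → collared-core law gap →
dense-network law gap → `AperiodicFrustratedLawGap`.  Nothing analytic happens here (pattern of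
`Theorems/GappedShellCensusAssembly.lean`); written by the decomp-a2c cell's lens-2 g18 seat. [folklore]
-/

namespace Summit.AtomisticToContinuum.Crystallization.Theorems.GrainCoreNetworkSplitAssembly

open Summit.AtomisticToContinuum.Crystallization.Theses.GrainCoreNetworkSplit

/-- **`GrainCoreNetworkSplit.Assembly` holds**: feed the four hypotheses, in order, to the route's deciding theorem
`Theses.GrainCoreNetworkSplit.closes`. [folklore] -/
theorem grainCoreNetworkSplit_assembly :
    Summit.AtomisticToContinuum.Crystallization.Theses.GrainCoreNetworkSplit.Assembly := by
  unfold Theses.GrainCoreNetworkSplit.Assembly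
  intro hDoor hG hC hN
  exact closes hDoor hG hC hN

end Summit.AtomisticToContinuum.Crystallization.Theorems.GrainCoreNetworkSplitAssembly
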